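import Summits.ResolutionOfSingularities.ResolutionOfSingularities.Theorems.LossEntryW13
import HarnessLib

/-!
# LossEntryW14 (= lens-3 g29 slice 8) — walk plumbing of the loss→entry law: α-steps on τ-STRAIGHTENED equations and the β-step normal forms

decomp-res-lens-3, gen 29 (NODE-g29 §3bis (N1)–(N3)).  TOOL at 0.  Imports `Theorems.LossEntryW13` (landing part 13 = slice 7).

§23 — the α-type chain step on the τ-straightened ordinate (hypothesis (h2) of `lawLossEntryAt_of_wallSteps'` along α-runs, for
ANY straightening parameter `τ`):
* `shear_comm_source` (`σ_{c,b,τ} σ_{c,a,g} = σ_{c,a,g} σ_{c,b,τ}`), `shear_snd_shear_fst` (THE THREE-SHEAR IDENTITY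
  `σ_{c,b,τ} σ_{b,a,g} = σ_{c,a,−τg} σ_{b,a,g} σ_{c,b,τ}`);
* `deletePthPowers_add_of_pth`, `exists_eq_deletePthPowers_add`, `shear_pth_supported` (Lucas), `chartTransform_pth_supported`,
  `alphaStep_deletePthPowers` («clean inside»: cleaning the input of `clean ∘ chart_a ∘ σσ` does not change the output);
* `deletePthPowers_shear_succ_alpha`: `clean(σ_{c,b,τ} F_{t+1}) = clean(chart_a(σ_{c,a,b_t(c)−τ b_t(b)} σ_{b,a,b_t(b)} clean(σ_{c,b,τ} F_t)))`;
* **`betaOf_polyPts_straightened_succ_alpha_le`**: at a move in the chart of the heavy wall letter `a`, for any `τ`,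
  `ŷ(clean σ_{c,b,τ} F_{t+1}) ≤ ŷ(clean σ_{c,b,τ} F_t)` in the frame `(a, b ; c)`, given the straightened polygon at `t` is non-empty
  with abscissa `< 1` (g29 probe: all 782 wall states).
§24 — the β-type chain step in normal form: `deletePthPowers_chartTransform_shear_deletePthPowers` («clean inside», one shear),
`polyPts_deletePthPowers_chartTransform_eq_entryPts` (pure `polyPts_succ_loss_b`), `st_succ_F_beta`
(`F_{v+1} = clean(chart_b(σ_{a,b,b_v(a)} G_v))`, `G_v = clean(σ_{c,b,b_v(c)} F_v)`: a β-loss acts on the straightened equation by a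
move translated ONLY along the wall letter) and **`polyPts_succ_beta_eq_entryPts`**: the new one-wall polygon in the frame `(b ; a, c)`
is `entryPts s (M+s) a c (clean(σ_{a,b,b_v(a)} G_v))` — (h2') for β-steps is an entry-polygon inequality for ONE-wall clean equations.
§25 — RE-STRAIGHTENING THROUGH A β-STEP ((N6)): `shear_thd_fst_shear_fst_snd` (`σ_{c,a,τ′} σ_{a,b,g} = σ_{a,b,g} σ_{c,a,τ′} σ_{c,b,−τ′g}`),
`betaStep_deletePthPowers`, `deletePthPowers_shear_succ_beta` (`clean(σ_{c,a,τ′} F_{v+1}) = clean(chart_b(σ_{a,b,b_v(a)} σ_{c,a,τ′}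
clean(σ_{c,b,b_v(c)−τ′b_v(a)} F_v)))`) and **`polyPts_succ_beta_straightened_eq_entryPts`** (the τ′-straightened new one-wall polygon is the
entry point set of `clean(σ_{a,b,b_v(a)} σ_{c,a,τ′} G)`, `G` the `(b_v(c) − τ′ b_v(a))`-straightened source).
`hLucas` (`q ∣ D`, `q ∤ T` ⇒ `C(D,T) = 0` in `K`) is the hypothesis slice 4 uses (discharged from `CharP K p`, `q = p^e` there).
-/

open MvPolynomial Finset
open Literature.AlgebraicGeometry.Resolution
open Literature.AlgebraicGeometry.Resolution.Hauser2010
open Literature.AlgebraicGeometry.Resolution.PointBlowup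
open Summit.ResolutionOfSingularities.ResolutionOfSingularities.Theorems.TightDefectClasses
open Summit.ResolutionOfSingularities.ResolutionOfSingularities.Theorems.TightDefectStrongWalks
open Summit.ResolutionOfSingularities.ResolutionOfSingularities.Theorems.ItineraryCutClasses
open Summit.ResolutionOfSingularities.ResolutionOfSingularities.Theorems.BoundaryLedger
open Summit.ResolutionOfSingularities.ResolutionOfSingularities.Theorems.ProximityCut
open Summit.ResolutionOfSingularities.ResolutionOfSingularities.Theorems.LossExitCone
open Summit.ResolutionOfSingularities.ResolutionOfSingularities.Theorems.LossPolygon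

/-! ## §23 THE α-STEP ON τ-STRAIGHTENED EQUATIONS (NODE-g29 §3bis (N2)): shear identities, «clean inside», and the walk-level lemma -/

namespace Summit.ResolutionOfSingularities.ResolutionOfSingularities.Theorems.LossPolygon

open Literature.AlgebraicGeometry.Resolution.HauserPerlega2024 (chartTransform_add chartTransform_monomial)

variable {K : Type} [Field K] {q : ℕ}

section StraightenedAlphaStep

variable {a b c : Fin 3}

/-- Shears with the same SOURCE letter commute: `σ_{c,b,τ} σ_{c,a,g} = σ_{c,a,g} σ_{c,b,τ}`. [folklore] -/
theorem shear_comm_source (hca : c ≠ a) (hcb : c ≠ b) (g τ : K) (F : MvPolynomial (Fin 3) K) :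
    shear c b τ (shear c a g F) = shear c a g (shear c b τ F) := by
  have key : (shear (K := K) c b τ).comp (shear c a g) = (shear c a g).comp (shear c b τ) := by
    refine MvPolynomial.algHom_ext fun w => ?_
    simp only [AlgHom.comp_apply]
    by_cases hw : w = c
    · subst hw
      simp [shear_X, hca.symm, hcb.symm]
      ring
    · simp [shear_X, hw]
  rw [← AlgHom.comp_apply, key, AlgHom.comp_apply]

/-- **THE THREE-SHEAR IDENTITY (PROVED):** straightening the ceiling letter into the section letter AFTER converting the section
letter into the wall letter equals doing it BEFORE, up to an extra shear of the ceiling letter into the wall letter: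
`σ_{c,b,τ} σ_{b,a,g} = σ_{c,a,−τg} σ_{b,a,g} σ_{c,b,τ}` (check on `F(u_a, u_b + g u_a, u_c + τ u_b)`). [NODE-g29 (N2); new] -/
theorem shear_snd_shear_fst (hab : a ≠ b) (hac : a ≠ c) (hbc : b ≠ c) (τ g : K) (F : MvPolynomial (Fin 3) K) :
    shear c b τ (shear b a g F) = shear c a (-(τ * g)) (shear b a g (shear c b τ F)) := by
  have key : (shear (K := K) c b τ).comp (shear b a g) =
      (shear c a (-(τ * g))).comp ((shear b a g).comp (shear c b τ)) := by
    refine MvPolynomial.algHom_ext fun w => ?_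
    simp only [AlgHom.comp_apply]
    rcases fin3_eq_or a b c w hab hac hbc with rfl | rfl | rfl
    · simp [shear_X, hab, hac]
    · simp [shear_X, hbc, hac]
    · simp [shear_X, hbc.symm, hac, hbc, map_neg, map_mul]
      ring
  rw [← AlgHom.comp_apply, key, AlgHom.comp_apply, AlgHom.comp_apply]

/-- Deleting `q`-th powers ignores an added polynomial supported on `q`-th power exponents. [folklore] -/
theorem deletePthPowers_add_of_pth (X P : MvPolynomial (Fin 3) K) (hP : ∀ E ∈ P.support, IsPthPowerExponent q E) :
    deletePthPowers q (X + P) = deletePthPowers q X := by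
  classical
  ext E
  rw [coeff_deletePthPowers, coeff_deletePthPowers]
  split_ifs with h
  · rfl
  · rw [coeff_add, notMem_support_iff.mp (fun hE => h (hP E hE)), add_zero]

/-- Every polynomial is its cleaning plus a polynomial supported on `q`-th power exponents. [folklore] -/
theorem exists_eq_deletePthPowers_add (X : MvPolynomial (Fin 3) K) :
    ∃ P : MvPolynomial (Fin 3) K, (∀ E ∈ P.support, IsPthPowerExponent q E) ∧ X = deletePthPowers q X + P := by
  classical
  refine ⟨X - deletePthPowers q X, fun E hE => ?_, by ring⟩
  by_contra hPE
  rw [mem_support_iff, coeff_sub, coeff_deletePthPowers, if_neg hPE, sub_self] at hE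
  exact hE rfl

/-- **LUCAS TRANSPORT (PROVED):** a shear maps polynomials supported on `q`-th power exponents to polynomials supported on
`q`-th power exponents (`(x + g y)^{qm}` has only `q`-th power terms in characteristic `p`, `q = p^e`). [folklore (Lucas)] -/
theorem shear_pth_supported (hab : a ≠ b) (hac : a ≠ c) (hbc : b ≠ c)
    (hLucas : ∀ D T : ℕ, q ∣ D → ¬ q ∣ T → ((D.choose T : ℕ) : K) = 0) (g : K) {P : MvPolynomial (Fin 3) K}
    (hP : ∀ E ∈ P.support, IsPthPowerExponent q E) : ∀ E' ∈ (shear c a g P).support, IsPthPowerExponent q E' := by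
  classical
  intro E' hE'
  by_contra hPE'
  rw [mem_support_iff, coeff_shear hab hac hbc] at hE'
  apply hE'
  refine Finset.sum_eq_zero fun D hD => Finset.sum_eq_zero fun n hn => ?_
  split_ifs with h
  · have hDp := (isPthPowerExponent_iff q D).mp (hP D hD)
    have hqn : ¬ q ∣ n := by
      intro hqn
      apply hPE'
      rw [← h, isPthPowerExponent_iff]
      intro w
      rcases fin3_eq_or a b c w hab hac hbc with rfl | rfl | rfl
      · rw [shearExp_apply_fst hab hac]; exact dvd_add (hDp _) hqn
      · rw [shearExp_apply_snd hab hbc]; exact hDp _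
      · rw [shearExp_apply_thd hac hbc]; exact Nat.dvd_sub (hDp _) hqn
    rw [hLucas (D c) n (hDp c) hqn, mul_zero]
  · rfl

/-- The chart transform maps `q`-th power exponents to `q`-th power exponents. [folklore] -/
theorem chartTransform_pth_supported (a : Fin 3) {P : MvPolynomial (Fin 3) K}
    (hP : ∀ E ∈ P.support, IsPthPowerExponent q E) : ∀ E' ∈ (chartTransform q a P).support, IsPthPowerExponent q E' := by
  classical
  intro E' hE'
  unfold chartTransform at hE'
  obtain ⟨D, hD, hE'D⟩ := Finset.mem_biUnion.mp (Finset.mem_of_subset (support_sum (s := P.support)) hE')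
  have hED : E' = chartExponent q a D := by
    by_contra hne
    rw [mem_support_iff, coeff_monomial, if_neg (Ne.symm hne)] at hE'D
    exact hE'D rfl
  have hDp := (isPthPowerExponent_iff q D).mp (hP D hD)
  rw [hED, isPthPowerExponent_iff]
  intro w
  rw [chartExponent_apply]
  split_ifs with hw
  · obtain ⟨b', c', hab', hac', hbc'⟩ : ∃ b' c' : Fin 3, a ≠ b' ∧ a ≠ c' ∧ b' ≠ c' := by
      rcases fin3_eq_or 0 1 2 a (by decide) (by decide) (by decide) with rfl | rfl | rfl
      · exact ⟨1, 2, by decide, by decide, by decide⟩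
      · exact ⟨0, 2, by decide, by decide, by decide⟩
      · exact ⟨0, 1, by decide, by decide, by decide⟩
    rw [degree_fin3 hab' hac' hbc']
    exact Nat.dvd_sub (dvd_add (dvd_add (hDp _) (hDp _)) (hDp _)) dvd_rfl
  · exact hDp w

/-- **«CLEAN INSIDE» (PROVED):** cleaning the INPUT of an α-step `clean ∘ chart_a ∘ σ_{c,a,g} ∘ σ_{b,a,g'}` does not change its
output (shears and the chart map are additive and preserve `q`-th-power-supported polynomials — Lucas). [NODE-g29 (N2); new] -/
theorem alphaStep_deletePthPowers (hab : a ≠ b) (hac : a ≠ c) (hbc : b ≠ c)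
    (hLucas : ∀ D T : ℕ, q ∣ D → ¬ q ∣ T → ((D.choose T : ℕ) : K) = 0) (g g' : K) (X : MvPolynomial (Fin 3) K) :
    deletePthPowers q (chartTransform q a (shear c a g (shear b a g' (deletePthPowers q X)))) =
      deletePthPowers q (chartTransform q a (shear c a g (shear b a g' X))) := by
  classical
  obtain ⟨P, hP, hX⟩ := exists_eq_deletePthPowers_add (q := q) X
  conv_rhs => rw [hX]
  rw [map_add, map_add, chartTransform_add, deletePthPowers_add_of_pth]
  exact chartTransform_pth_supported a
    (shear_pth_supported hab hac hbc hLucas g (shear_pth_supported hac hab hbc.symm hLucas g' hP))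

end StraightenedAlphaStep

section StraightenedAlphaStepWalk

variable [DecidableEq K] {s₀ : State (Fin 3) K}

/-- The τ-STRAIGHTENED equation after an α-type move: `clean(σ_{c,b,τ} F_{t+1}) = clean(chart_a(σ_{c,a,g''} σ_{b,a,b_t(b)} clean(σ_{c,b,τ} F_t)))`
with `g'' = b_t(c) − τ b_t(b)` — straightenings commute with α-steps up to a modified translation. [NODE-g29 (N2); new] -/
theorem deletePthPowers_shear_succ_alpha (hs : IsRoot q s₀) (W : ForcedWalk q s₀) (t : ℕ) {a b c : Fin 3} (hab : a ≠ b)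
    (hac : a ≠ c) (hbc : b ≠ c) (hj : W.j t = a)
    (hLucas : ∀ D T : ℕ, q ∣ D → ¬ q ∣ T → ((D.choose T : ℕ) : K) = 0) (τ : K) :
    deletePthPowers q (shear c b τ (W.st (t + 1)).F) =
      deletePthPowers q (chartTransform q a (shear c a (-(τ * W.b t b) + W.b t c)
        (shear b a (W.b t b) (deletePthPowers q (shear c b τ (W.st t).F))))) := by
  classical
  have hH : ∀ E ∈ (shear c a (W.b t c) (shear b a (W.b t b) (W.st t).F)).support, q ≤ E.degree :=
    fun E hE => le_degree_of_mem_support_two_shears hs W t a c b _ _ hE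
  rw [st_succ_F_two_shears hs W t hac.symm hab.symm hbc.symm hj,
    deletePthPowers_shear_deletePthPowers_chartTransform hab.symm hbc hac hLucas τ hH,
    shear_comm_source hac.symm hbc.symm (W.b t c) τ, shear_snd_shear_fst hab hac hbc τ (W.b t b),
    shear_shear_same hac.symm, alphaStep_deletePthPowers hab hac hbc hLucas]

/-- **(h2') FOR AN α-STEP ON THE τ-STRAIGHTENED ORDINATE (PROVED; NODE-g29 §3bis (N2)):** at a move in the chart of the heavy
wall letter `a` translated along both other letters, for ANY straightening parameter `τ`, the ordinate of the lex-min vertex of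
the one-wall polygon of the τ-straightened equation `clean(σ_{c,b,τ} F)` in the fixed frame `(a, b ; c)` does not increase —
provided the straightened polygon at `t` is non-empty with abscissa `< 1` (g29 probe: `x̂ < 1` at all 782 wall states, max `2/3`).
With `τ = b_u(c)` read from the first non-α move `u` (N1) this is hypothesis (h2) of `lawLossEntryAt_of_wallSteps'` along α-runs. [new] -/
theorem betaOf_polyPts_straightened_succ_alpha_le (hs : IsRoot q s₀) (W : ForcedWalk q s₀) (t : ℕ) {a b c : Fin 3}
    (hab : a ≠ b) (hac : a ≠ c) (hbc : b ≠ c) (hj : W.j t = a)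
    (hLucas : ∀ D T : ℕ, q ∣ D → ¬ q ∣ T → ((D.choose T : ℕ) : K) = 0) (τ : K) {s : ℕ}
    (hrb : (W.st (t + 1)).r b = (W.st t).r b) (hra : (W.st (t + 1)).r a + q = s + (W.st t).r a + (W.st t).r b)
    (hrc : (W.st t).r c = 0) (hrc' : (W.st (t + 1)).r c = 0)
    (hne : (polyPts s (W.st t).r a b c (deletePthPowers q (shear c b τ (W.st t).F))).Nonempty)
    (hα : alphaOf (polyPts s (W.st t).r a b c (deletePthPowers q (shear c b τ (W.st t).F))) < 1) :
    betaOf (polyPts s (W.st (t + 1)).r a b c (deletePthPowers q (shear c b τ (W.st (t + 1)).F))) ≤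
      betaOf (polyPts s (W.st t).r a b c (deletePthPowers q (shear c b τ (W.st t).F))) := by
  classical
  rw [deletePthPowers_shear_succ_alpha hs W t hab hac hbc hj hLucas τ]
  refine betaOf_polyPts_alphaStep_le hab hac hbc hrb hra hrc hrc' _ _ (fun D hD => ?_) (fun D hD => ?_) (fun D hD => ?_) hne hα
  · rw [support_deletePthPowers', Finset.mem_filter] at hD
    obtain ⟨D₀, hD₀, hdeg⟩ := exists_degree_eq_of_mem_support_shear c b τ _ hD.1
    rw [hdeg]; exact le_degree_of_mem_support hs W t hD₀
  · rw [support_deletePthPowers', Finset.mem_filter] at hD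
    obtain ⟨D₀, hD₀, n, -, hDE⟩ := exists_shearExp_eq_of_mem_support_shear hab.symm hbc hac τ _ hD.1
    rw [← hDE, shearExp_apply_snd hab.symm hac]
    exact walk_r hs W t D₀ hD₀ a
  · rw [support_deletePthPowers', Finset.mem_filter] at hD
    exact hD.2

end StraightenedAlphaStepWalk

end Summit.ResolutionOfSingularities.ResolutionOfSingularities.Theorems.LossPolygon

/-! ## §24 THE β-TYPE CHAIN STEP IN NORMAL FORM: a β-loss acts on the τ-straightened equation by a move in the chart of the section letter translated ONLY along the wall letter; its one-wall polygon is an ENTRY POINT SET (NODE-g29 §3bis (i), for g30) -/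

namespace Summit.ResolutionOfSingularities.ResolutionOfSingularities.Theorems.LossPolygon

open Literature.AlgebraicGeometry.Resolution.HauserPerlega2024 (chartTransform_add chartTransform_monomial)

variable {K : Type} [Field K] {q : ℕ}

section BetaStep

variable {a b c : Fin 3}

/-- «Clean inside», one shear: `clean(chart_b(σ_{a,b,g}(clean X))) = clean(chart_b(σ_{a,b,g} X))`. [Lucas; new] -/
theorem deletePthPowers_chartTransform_shear_deletePthPowers (hab : a ≠ b) (hac : a ≠ c) (hbc : b ≠ c)
    (hLucas : ∀ D T : ℕ, q ∣ D → ¬ q ∣ T → ((D.choose T : ℕ) : K) = 0) (j : Fin 3) (g : K)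
    (X : MvPolynomial (Fin 3) K) :
    deletePthPowers q (chartTransform q j (shear a b g (deletePthPowers q X))) =
      deletePthPowers q (chartTransform q j (shear a b g X)) := by
  classical
  obtain ⟨P, hP, hX⟩ := exists_eq_deletePthPowers_add (q := q) X
  conv_rhs => rw [hX]
  rw [map_add, chartTransform_add, deletePthPowers_add_of_pth]
  exact chartTransform_pth_supported j (shear_pth_supported hbc hab.symm hac.symm hLucas g hP)

/-- **THE ONE-WALL POLYGON AFTER A MOVE IN THE CHART OF THE SECTION LETTER IS AN ENTRY POINT SET, PURE FORM (PROVED):**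
for `H` with all degrees `≥ o = M + s` and the new wall `M'` with `q + M' = o` on the chart letter `b` (no other walls), the point
set of `clean(chart_b H)` in the frame `(b ; a, c)` is `entryPts s o a c (clean H)`.  [`polyPts_succ_loss_b` without the walk; new] -/
theorem polyPts_deletePthPowers_chartTransform_eq_entryPts (hab : a ≠ b) (hbc : b ≠ c) {s o M' : ℕ}
    (hoM : q + M' = o) {r₁ : Fin 3 →₀ ℕ} (hr₁b : r₁ b = M') (hr₁a : r₁ a = 0) (hr₁c : r₁ c = 0)
    {H : MvPolynomial (Fin 3) K} (hH : ∀ E ∈ H.support, o ≤ E.degree) :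
    polyPts s r₁ b a c (deletePthPowers q (chartTransform q b H)) = entryPts s o a c (deletePthPowers q H) := by
  classical
  have hHq : ∀ E ∈ H.support, q ≤ E.degree := fun E hE => le_trans (by omega) (hH E hE)
  have hsupp := support_deletePthPowers_chartTransform b H hHq
  ext x
  simp only [polyPts, entryPts, Finset.mem_image, Finset.mem_filter]
  constructor
  · rintro ⟨D, ⟨hD, hDl⟩, rfl⟩
    rw [hsupp, Finset.mem_image] at hD
    obtain ⟨E, hE, rfl⟩ := hD
    have hEsupp := (Finset.mem_filter.mp hE).1
    refine ⟨E, ⟨by rw [support_deletePthPowers']; exact hE, ?_⟩,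
      (resPoint_chartExponent_eq_entryPt hab hbc hr₁b hr₁a hr₁c hoM (hHq E hEsupp)).symm⟩
    rw [chartExponent_apply, if_neg (Ne.symm hbc), hr₁c, add_zero] at hDl
    exact hDl
  · rintro ⟨E, ⟨hE, hEl⟩, rfl⟩
    rw [support_deletePthPowers'] at hE
    have hEsupp := (Finset.mem_filter.mp hE).1
    refine ⟨chartExponent q b E, ⟨?_, ?_⟩, resPoint_chartExponent_eq_entryPt hab hbc hr₁b hr₁a hr₁c hoM (hHq E hEsupp)⟩
    · rw [hsupp]; exact Finset.mem_image_of_mem _ hE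
    · rw [chartExponent_apply, if_neg (Ne.symm hbc), hr₁c, add_zero]; exact hEl

end BetaStep

section BetaStepWalk

variable [DecidableEq K] {s₀ : State (Fin 3) K}

/-- **β-STEP NORMAL FORM (PROVED):** a move in the chart `b` of a NON-wall letter acts on the τ-straightened equation
`G_v = clean(σ_{c,b,τ} F_v)`, `τ = b_v(c)` its own translation along the third letter, by a move translated ONLY along the wall
letter `a`: `F_{v+1} = clean(chart_b(σ_{a,b,b_v(a)} G_v))`. [NODE-g29 §3bis; new] -/
theorem st_succ_F_beta (hs : IsRoot q s₀) (W : ForcedWalk q s₀) (v : ℕ) {a b c : Fin 3} (hab : a ≠ b) (hac : a ≠ c)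
    (hbc : b ≠ c) (hj : W.j v = b) (hLucas : ∀ D T : ℕ, q ∣ D → ¬ q ∣ T → ((D.choose T : ℕ) : K) = 0) :
    (W.st (v + 1)).F =
      deletePthPowers q (chartTransform q b (shear a b (W.b v a) (deletePthPowers q (shear c b (W.b v c) (W.st v).F)))) := by
  rw [st_succ_F_two_shears hs W v hab (Ne.symm hbc) hac hj,
    deletePthPowers_chartTransform_shear_deletePthPowers hab hac hbc hLucas b (W.b v a)]

/-- **THE ONE-WALL POLYGON AFTER A β-TYPE CHAIN LOSS IS THE ENTRY POINT SET OF THE STRAIGHTENED EQUATION (PROVED):** at a wall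
state `v` (`r_v = M·e_a`, every monomial of degree `≥ M + s`) whose move is in the chart `b ≠ a` and leaves the one-wall state
`r_{v+1} = M'·e_b`, `q + M' = M + s`: `polyPts s r_{v+1} b a c F_{v+1} = entryPts s (M+s) a c (clean(σ_{a,b,b_v(a)} G_v))` with
`G_v = clean(σ_{c,b,b_v(c)} F_v)` — so (h2') for β-steps is an ENTRY-POLYGON inequality for the one-wall clean equation `G_v`
(frame `(b ; a, c)`; NODE-g29 §3bis (i): `x' = x + y − 1`). [new] -/
theorem polyPts_succ_beta_eq_entryPts (hs : IsRoot q s₀) (W : ForcedWalk q s₀) (v : ℕ) {a b c : Fin 3} (hab : a ≠ b)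
    (hac : a ≠ c) (hbc : b ≠ c) (hj : W.j v = b) (hLucas : ∀ D T : ℕ, q ∣ D → ¬ q ∣ T → ((D.choose T : ℕ) : K) = 0)
    {s M M' : ℕ} (hoM : q + M' = M + s) (hord : ∀ D ∈ (W.st v).F.support, M + s ≤ D.degree)
    (hr₁b : (W.st (v + 1)).r b = M') (hr₁a : (W.st (v + 1)).r a = 0) (hr₁c : (W.st (v + 1)).r c = 0) :
    polyPts s (W.st (v + 1)).r b a c (W.st (v + 1)).F =
      entryPts s (M + s) a c (deletePthPowers q (shear a b (W.b v a)
        (deletePthPowers q (shear c b (W.b v c) (W.st v).F)))) := by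
  classical
  rw [st_succ_F_beta hs W v hab hac hbc hj hLucas]
  refine polyPts_deletePthPowers_chartTransform_eq_entryPts hab hbc hoM hr₁b hr₁a hr₁c fun E hE => ?_
  refine le_degree_of_mem_support_shear hbc hab.symm hac.symm _ (fun D hD => ?_) hE
  rw [support_deletePthPowers', Finset.mem_filter] at hD
  exact le_degree_of_mem_support_shear hab.symm hbc hac _ hord hD.1

end BetaStepWalk

end Summit.ResolutionOfSingularities.ResolutionOfSingularities.Theorems.LossPolygon

/-! ## §25 RE-STRAIGHTENING THROUGH A β-STEP: the straightening `σ_{c,a,τ′}` of the NEW wall state (ceiling letter into its section letter `a` = the old wall letter) pulls back through the β-move to the source as an extra `c → b` straightening `−τ′g` plus `σ_{c,a,τ′}` (NODE-g29 §3bis (N6), for g30) -/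

namespace Summit.ResolutionOfSingularities.ResolutionOfSingularities.Theorems.LossPolygon

open Literature.AlgebraicGeometry.Resolution.HauserPerlega2024 (chartTransform_add chartTransform_monomial)

variable {K : Type} [Field K] {q : ℕ}

section BetaRestraighten

variable {a b c : Fin 3}

/-- THE THREE-SHEAR IDENTITY, β-version: `σ_{c,a,τ′} σ_{a,b,g} = σ_{a,b,g} σ_{c,a,τ′} σ_{c,b,−τ′g}` (check on `F(u_a + g u_b, u_b, u_c + τ′u_a)`).
[elementary; new] -/
theorem shear_thd_fst_shear_fst_snd (hab : a ≠ b) (hac : a ≠ c) (hbc : b ≠ c) (τ' g : K) (F : MvPolynomial (Fin 3) K) :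
    shear c a τ' (shear a b g F) = shear a b g (shear c a τ' (shear c b (-(τ' * g)) F)) := by
  have key : (shear (K := K) c a τ').comp (shear a b g) =
      (shear a b g).comp ((shear c a τ').comp (shear c b (-(τ' * g)))) := by
    refine MvPolynomial.algHom_ext fun w => ?_
    simp only [AlgHom.comp_apply]
    rcases fin3_eq_or a b c w hab hac hbc with rfl | rfl | rfl
    · simp [shear_X, hac, hbc]
    · simp [shear_X, hab.symm, hbc]
    · simp [shear_X, hac.symm, hbc, hab.symm, map_neg, map_mul]
      ring
  rw [← AlgHom.comp_apply, key, AlgHom.comp_apply, AlgHom.comp_apply]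

/-- «Clean inside» for the β-step with re-straightening: `clean(chart_b(σ_{a,b,g} σ_{c,a,τ′} clean X)) = clean(chart_b(σ_{a,b,g} σ_{c,a,τ′} X))`.
[Lucas; new] -/
theorem betaStep_deletePthPowers (hab : a ≠ b) (hac : a ≠ c) (hbc : b ≠ c)
    (hLucas : ∀ D T : ℕ, q ∣ D → ¬ q ∣ T → ((D.choose T : ℕ) : K) = 0) (g τ' : K) (X : MvPolynomial (Fin 3) K) :
    deletePthPowers q (chartTransform q b (shear a b g (shear c a τ' (deletePthPowers q X)))) =
      deletePthPowers q (chartTransform q b (shear a b g (shear c a τ' X))) := by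
  classical
  obtain ⟨P, hP, hX⟩ := exists_eq_deletePthPowers_add (q := q) X
  conv_rhs => rw [hX]
  rw [map_add, map_add, chartTransform_add, deletePthPowers_add_of_pth]
  exact chartTransform_pth_supported b
    (shear_pth_supported hbc hab.symm hac.symm hLucas g (shear_pth_supported hab hac hbc hLucas τ' hP))

end BetaRestraighten

section BetaRestraightenWalk

variable [DecidableEq K] {s₀ : State (Fin 3) K}

/-- **β-STEP NORMAL FORM WITH RE-STRAIGHTENING (PROVED):** for a move in the chart `b` of a non-wall letter and ANY `τ′`,
`clean(σ_{c,a,τ′} F_{v+1}) = clean(chart_b(σ_{a,b,b_v(a)} σ_{c,a,τ′} clean(σ_{c,b, b_v(c) − τ′ b_v(a)} F_v)))`: straightening the new wall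
state along `c → a` (its section letter when the next non-α move is in the chart `a`) is seen at the source as the straightening
`τ = b_v(c) − τ′ b_v(a)` along `c → b` followed by `σ_{c,a,τ′}` (which preserves the wall `u_a^M`). [NODE-g29 §3bis (N6); new] -/
theorem deletePthPowers_shear_succ_beta (hs : IsRoot q s₀) (W : ForcedWalk q s₀) (v : ℕ) {a b c : Fin 3} (hab : a ≠ b)
    (hac : a ≠ c) (hbc : b ≠ c) (hj : W.j v = b) (hLucas : ∀ D T : ℕ, q ∣ D → ¬ q ∣ T → ((D.choose T : ℕ) : K) = 0)
    (τ' : K) :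
    deletePthPowers q (shear c a τ' (W.st (v + 1)).F) =
      deletePthPowers q (chartTransform q b (shear a b (W.b v a) (shear c a τ'
        (deletePthPowers q (shear c b (W.b v c - τ' * W.b v a) (W.st v).F))))) := by
  classical
  have hH : ∀ E ∈ (shear a b (W.b v a) (shear c b (W.b v c) (W.st v).F)).support, q ≤ E.degree := fun E hE =>
    le_degree_of_mem_support_shear hbc hab.symm hac.symm _
      (fun D hD => le_degree_of_mem_support_shear hab.symm hbc hac _ (fun D' hD' => le_degree_of_mem_support hs W v hD') hD) hE
  rw [st_succ_F_two_shears hs W v hab (Ne.symm hbc) hac hj, deletePthPowers_shear_deletePthPowers_chartTransform hab hac hbc hLucas τ' hH,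
    shear_thd_fst_shear_fst_snd hab hac hbc τ' (W.b v a), shear_shear_same hbc.symm, ← sub_eq_add_neg,
    betaStep_deletePthPowers hab hac hbc hLucas]

/-- **THE RE-STRAIGHTENED ONE-WALL POLYGON AFTER A β-STEP IS AN ENTRY POINT SET (PROVED):** with the hypotheses of
`polyPts_succ_beta_eq_entryPts` and any `τ′`:
`polyPts s r_{v+1} b a c (clean(σ_{c,a,τ′} F_{v+1})) = entryPts s (M+s) a c (clean(σ_{a,b,b_v(a)} σ_{c,a,τ′} clean(σ_{c,b,b_v(c)−τ′b_v(a)} F_v)))`.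
So (h2') at a β-step followed (after an α-run) by a move in the chart `a` compares the lex-min ordinate of this entry set with
`B(v)` = the ordinate of the `(b_v(c) − τ′ b_v(a))`-straightened source polygon. [NODE-g29 §3bis (N6); new] -/
theorem polyPts_succ_beta_straightened_eq_entryPts (hs : IsRoot q s₀) (W : ForcedWalk q s₀) (v : ℕ) {a b c : Fin 3} (hab : a ≠ b)
    (hac : a ≠ c) (hbc : b ≠ c) (hj : W.j v = b) (hLucas : ∀ D T : ℕ, q ∣ D → ¬ q ∣ T → ((D.choose T : ℕ) : K) = 0)
    (τ' : K) {s M M' : ℕ} (hoM : q + M' = M + s) (hord : ∀ D ∈ (W.st v).F.support, M + s ≤ D.degree)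
    (hr₁b : (W.st (v + 1)).r b = M') (hr₁a : (W.st (v + 1)).r a = 0) (hr₁c : (W.st (v + 1)).r c = 0) :
    polyPts s (W.st (v + 1)).r b a c (deletePthPowers q (shear c a τ' (W.st (v + 1)).F)) =
      entryPts s (M + s) a c (deletePthPowers q (shear a b (W.b v a) (shear c a τ'
        (deletePthPowers q (shear c b (W.b v c - τ' * W.b v a) (W.st v).F))))) := by
  classical
  rw [deletePthPowers_shear_succ_beta hs W v hab hac hbc hj hLucas τ']
  refine polyPts_deletePthPowers_chartTransform_eq_entryPts hab hbc hoM hr₁b hr₁a hr₁c fun E hE => ?_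
  refine le_degree_of_mem_support_shear hbc hab.symm hac.symm _ (fun D hD => ?_) hE
  refine le_degree_of_mem_support_shear hab hac hbc _ (fun D' hD' => ?_) hD
  rw [support_deletePthPowers', Finset.mem_filter] at hD'
  exact le_degree_of_mem_support_shear hab.symm hbc hac _ hord hD'.1

end BetaRestraightenWalk

end Summit.ResolutionOfSingularities.ResolutionOfSingularities.Theorems.LossPolygon
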